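import Literature.MathematicalPhysics.QuantumFieldTheory.Balaban1983to89.B3Ineq210RegularRegion

/-!
# Bałaban, *(Higgs)₂,₃ quantum fields in a finite volume III* [B3] — the averaged vector-leg bound (2.12) p. 426,
# `|G^η_{(j)}(Γ^{(j+1)}_{x_{j+1},x}, b)| ≤ O(1)(L^jη)^{−d+3}e^{−δ₁(L^jη)^{−1}dist(B^j(x),b)}`, PROVED ON A REGION `Ω ⊆ T_η`
# (a union of big blocks) for the vector-field scale pieces (zero background, [B1] p. 608 «N = d and an external vector
# field A = 0»), at the points carrying the interior margin of Proposition I.2.1 — `ScaledKernels.Ineq212 δ₁ C` (and `Ineq210`)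
# DISCHARGED for a concrete carrier `zeroRegionKernelsV`

statement-level skeleton of published theorems with citation tags; proofs where landed; nothing here is a claim about the Yang–Mills mass gap

T. Bałaban, Commun. Math. Phys. **88** (1983) 411–445 [cite: Balaban1983Higgs3], (2.12) p. 426 [PDF 16] and (1.3) p. 412 [PDF 2];
part I, Commun. Math. Phys. **85** (1982) 603–626 [cite: Balaban1982Higgs1], (2.1)–(2.3) p. 608 (the contours `Γ_{y,x}`,
`Γ^{(k)}_{y,x}`, `A(Γ) = Σ_{b⊂Γ}A_b`) and Proposition 2.1 p. 610 (the clause «dist({x,x′}, Ωᶜ) ≥ R₀»).  PDF held: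
`paper:balaban1983-higgs-2-3-quantum-fields-finite-volume` (journal page = PDF page + 410).

CITATION HEADER (lean-in-tree rule).  Part of the lit-balaban TYPED SKELETON (HOME `run/shared/lean/pub/lit-balaban/`), Phase 2:
SKELETON row **B3.Eq2.12** (`HOME/lit-balaban-r15/ROWS-B3.md`, fold owner r15; decl of record
`B3Sect2StatementsPart2.ScaledKernels.Ineq212`, typed over the ABSTRACT carrier `ScaledKernels`).  REGION TWIN of p03's
`B3Ineq212ZeroBox` (Neumann boxes `□ ⊂ ℤ^d`) and `B3Ineq212ZeroTorus` (`Ω = T_η`): the same printed inequality for the scale pieces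
of the propagators `G_k(Ω, 0)` of a union of big blocks `Ω ⊆ T_η`, i.e. the «region generality» left open in the owner's
`B3-CLOSURE.md` §5 item 5.  A thin assembly over r14's `B3Ineq210RegularRegion` (p340643: the region pieces `pieceR`, the interior
predicate `Interior`, **(2.10) on regions `ineq210_regularRegion_explicit`**) and the contour combinatorics of the (Higgs)₂,₃ lattice
(`HiggsAveraging.multiContourSum` = `A(Γ^{(k)}_{x_k,x})`; p17/p23's `B2Ineq329PrismHolonomy.{abs_multiContourSum_le, sum_steps_le,
blockIter_stair_src}`; r14's `B1Cor23ZeroFieldRegion.tdist_le_of_blockIter_eq_real`); nothing of these is re-proved.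

WHAT IS PRINTED (B3 p. 426 [PDF 16], verbatim): *"Of course the same inequalities hold for vector field propagators, but we have
to estimate some additional expressions also. If a leg A′ of the line is in one of the vertices (1.14) and (1.15), then we have
the expression A′^{(j),η}(Γ^{j+1}_{x_{j+1},x}) on the basis of (1.3). For each such expression we have an additional factor L^jη on
the right side, e.g. we have |G^η_{(j)}(Γ^{(j+1)}_{x_{j+1},x}, b)| ≤ O(1)(L^jη)^{−d+3}e^{−δ₁(L^jη)^{−1}dist(B^j(x),b)}. (2.12)"*;
(B3 p. 412, (1.3)): *"For an arbitrary vector field A defined on η-lattice and an arbitrary contour Γ of this lattice we put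
A(Γ) = Σ_{b⊂Γ} ηA_b"*; [B1] p. 608: *"Γ^{(k)}_{y,x} = Γ_{y,x_{k−1}} ∪ Γ_{x_{k−1},x_{k−2}} ∪ … ∪ Γ_{x_1,x} (2.2)"*, *"The renormalization
transformations for vector fields will be obtained by taking N = d and an external vector field A = 0"*; [B1] p. 610,
Proposition 2.1: the inequalities hold for `x, x′ ∈ Ω` with «dist({x,x′}, Ωᶜ) ≥ R₀».

WHAT THIS FILE PROVES (kind «model-instance», G.1 of `HOME/PHASE2-TARGETS.md`), on the (Higgs)₂,₃ lattice `HiggsLattice`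
(volume `P`, finest torus `T_ε = Site P 0`, `η = ε`), for a big-block union `Ω ⊆ T_ε` (`B1TorusRegionHSizes.IsBigBlockUnion k K₀ Ω`):
* §1 the vector field at zero background as `d` copies of the FREE one-component scalar field ([B1] p. 608): the trivial charge data
  `chargeOne` (`N = 1`, `e = 0`, `q = 0`, so `U ≡ 1`), the kernel `scalarKerR Ω m² a k j z x′ = ε^{−d}·[G^η_{(j)}(Ω,0)e_{x′}](z)` of r14's
  region scale piece `pieceR chargeOne Ω 0 m² a k j` ((2.6) for the region operators), and its bound by r14's `absG`-quantity
  (`abs_scalarKerR_le`); pieces `j ≥ k` vanish (`scalarKerR_of_le`).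
* §2 the (2.12) objects: the bond kernel `vecPieceR j b′ b = δ_{ν(b′)μ(b)}·G^η_{(j)}(Ω,0; z(b′), x_b)`, the contour sum
  `gsumR j x b = Σ_{b′⊂Γ^{(j+1)}_{x_{j+1},x}} η·vecPieceR j b′ b` (`= G^η_{(j)}(Γ^{(j+1)}_{x_{j+1},x}, b)`, the leg `A′(Γ^{(j+1)}_{x_{j+1},x})` of
  (1.3) contracted with `A′_b`, realised by `HiggsAveraging.multiContourSum`), the block point set `B^j(x)` and
  `distBlockR j x b = η·dist(B^j(x), b)` with `distBlockR_le` (`≤ η|x − x_b|`).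
* §3 the interior predicates: r14's `Interior k K₀ Ω` (Prop. I.2.1's `R₀`-margin) for the initial point of `b`, and `InteriorK k K₀ Ω x`
  («every point of the `k`-block of `x` is interior» — the contour `Γ^{(j+1)}_{x_{j+1},x}`, `j < k`, stays in that block); the CARRIER
  `zeroRegionKernelsV hL1 Ω m² a k K₀ : ScaledKernels` (`Site` = the `InteriorK` points, `Bond` = bonds with interior initial point,
  `absG`/`absDG` = r14's region kernels at `(chargeOne, A = 0)`, `absGavg j x b = |gsumR j x b|`, `distBlock = distBlockR`; the (2.5)/(2.11)
  fields `0`), `scaleV_eq`, and the full-torus facts `interior_univ'`/`interiorK_univ` (for `Ω = T_ε` every site qualifies).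
* §4 THE ENGINE `abs_gsumR_le`: from (2.10) at interior pairs (hypothesis `h210`, the shape of r14's `ineq210_regularRegion_explicit`)
  to `|gsumR j x b| ≤ d·L·e^{δ₁L}·C·(L^jη)^{3−d}e^{−δ₁(L^jη)^{−1}η|x − x_b|}` — the print's «additional factor L^jη»: the contour has
  `≤ d(L^{j+1} − 1)` bonds of weight `η` (`sum_steps_le`), each in the `(j+1)`-block of `x` (`blockIter_stair_src`, so interior and within
  `L^{j+1} − 1` of `x`), each carrying the pointwise bound (2.10) with `|z − x_b| ≥ |x − x_b| − L^{j+1}`.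
* §5 **`ineq212_zeroRegion`**: for `d ≥ 1`, `L ≥ 2`, `a > 0`, `m² > 0`: `∃ K₀,min ∀ K₀ ≥ K₀,min ∃ δ₁, C > 0` such that for EVERY volume
  `P` with these `d, L` and `K₀ ∣ M`, every scale `1 ≤ k ≤ K` with `L^kε ≤ 1` and at least three cubes a side, and EVERY big-block
  union `Ω`, `(zeroRegionKernelsV … Ω m² a k K₀).Ineq212 δ₁ C`; **`ineq210_zeroRegion`** ((2.10) for the same carrier) and the conjunction
  `ineq210_and_212_zeroRegion`; §6 the case `Ω = T_ε` (`ineq212_zeroRegion_univ`, every site and bond, every `L ≥ 2`);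
  §7 (v1.1) **`zeroRegion_hypotheses_nonvacuous`**: the hypotheses are met by a PROPER big-block union (a slab of cells, `Ω ≠ T_ε`) whose
  carrier is inhabited — a site with interior `k`-block and a bond with interior initial point — at every admissible cube size
  (r14's `regularRegion_hypotheses_nonvacuous` construction with the base point at a block corner).

HONEST SCOPE / DECLARED DIVERGENCES (F7).  (i) Zero background only: the vector-field propagators carry no background ([B1] p. 608),
their pieces are `δ_{νμ}` times the free (`N = 1`, `U ≡ 1`) scalar pieces of the REGION operators `G^ε_j(Ω,0)`, `C^{(j)}(Ω,0)` of r14's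
`pieceR` (Neumann Laplacian of `Ω`, (I.2.17)/(I.2.20)/(I.2.30)); the mass parameter `m² > 0` of the input is, for the vector field, the
mass `μ₀² > 0` of the Feynman-gauge action (I.1.11) `½⟨A,(−Δ^ε + μ₀²)A⟩` ([B1] p. 605 «μ₀² > 0»).  (ii) Points: `x` ranges over the
sites whose whole `k`-block carries r14's interior margin `2r_S + 2L^kK₀(d+1) + 1` (this realises «dist({x,x′}, Ωᶜ) ≥ R₀» of
Proposition I.2.1 for every point of the contour `Γ^{(j+1)}_{x_{j+1},x} ⊂ B^{j+1}(x_{j+1}) ⊂ B^k(x_k)`), `b` over the bonds whose initial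
point carries the margin; for `Ω = T_ε` these are all sites and all bonds (§6).  NOT covered: points/bonds of `Ω` closer than the
margin to `Ωᶜ`; regions that are not unions of `L^kK₀`-cells; volumes with `K₀ ∤ M` or fewer than three cubes a side.  (iii)
`dist(B^j(x), b)` = `η·min_{z ∈ B^j(x)} min(|z − x_b|, |z − (x_b + e_μ)|)` in the torus distance (I.1.3) (sup norm, lattice units; the
print does not fix the norm); only `dist(B^j(x), b) ≤ η|x − x_b|` is used.  (iv) Scales: the pieces `j ≥ k` are `0` ((2.6) has `k`
terms), so (2.12) is trivial there; for `j < k` the contour `Γ^{(j+1)}` is the one of [B1] (2.2) typed by `HiggsAveraging.multiContourSum`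
(corner-anchored blocks, `j + 1 ≤ k ≤ K`).  (v) Constants existential, depending on `d, L, a, m², K₀` (print: O(1)), uniform in the
volume, in `Ω`, in `k` and `j`; quantifier shape inherited from `ineq210_regularRegion_explicit` (its `E₀`/charge clauses are met by
`e = 0`).  (vi) ROUTE = the print's; (2.10) on regions is r14's theorem BY NAME; no Literature fact is minted (`chargeOne`, `idxOne`,
`scalarKerR`, `vecPieceR`, `gsumR`, `blockSitesR`, `distBlockR`, `InteriorK`, `zeroRegionKernelsV` are concrete `def`s; every
theorem is proved); standard axioms.  Value = kernel certificate of a located by-reference step of B3 for the zero-background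
region instance, NOT summit progress.  Unit `lit-balaban-p37` gen 75 (Phase-2 proof seat p37; literature-prover-lit-balaban-p37-g75-0);
HOME `run/shared/lean/pub/lit-balaban/` (row B3.Eq2.12, FILED.md, STATUS.md).
-/

noncomputable section

open scoped BigOperators

namespace Literature.MathematicalPhysics.QuantumFieldTheory.Balaban1983to89.B3Ineq212ZeroRegion

open HiggsLattice (ChargeData covDeriv)
open HiggsCovariance (E)
open HiggsAveraging (blockIter toFinest shiftN multiContourSum blockK mem_blockK)
open B1Eq230FluctCov (mat Ix cb)
open B1TorusRegionHSizes (IsBigBlockUnion isBigBlockUnion_univ)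
open B1TorusCubeCover (half)
open B1TorusCubeLocality26 (rS)
open B2Restr216Lattice (cornerN)
open B2Ineq329PrismHolonomy (abs_multiContourSum_le blockIter_stair_src sum_steps_le)
open B2Ineq329ZeroAveraging (multiContourSum_zero_field)
open B1Cor23ZeroFieldRegion (tdist_le_of_blockIter_eq_real)
open B1Ineq234LevelZero (tdist_comm tdist_triangle_real)
open B3Sect2StatementsPart2 (ScaledKernels)
open B3Ineq210RegularTorus (abs_mat_le_norm mesh_eq_pow_mul)
open B3Ineq210RegularRegion (Interior pieceR pieceR_of_le ineq210_regularRegion_explicit)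

variable {P : HiggsLattice.Params}

/-! ## §1 The vector field at zero background: `d` copies of the free one-component scalar field ([B1] p. 608) -/

/-- **The trivial charge data** `N = 1`, `e = 0`, `q = 0` (so `U(A) = exp(qηeA) ≡ 1`): the free one-component scalar field, of which
the vector field at zero background consists of `d` independent copies ([B1] p. 608: *"taking N = d and an external vector field
A = 0"*). [cite: Balaban1982Higgs1, (1.7) p.605, p.608] -/
def chargeOne : ChargeData 1 where
  e := 0
  q := 0
  q_skew := by rw [neg_zero]; exact star_zero (E 1 →L[ℝ] E 1)
  norm_q_le := by simp

/-- `e = 0` for the trivial charge data. [cite: Balaban1982Higgs1, (1.7) p.605] -/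
@[simp] theorem chargeOne_e : chargeOne.e = 0 := rfl

/-- The unique internal index of the one-component field (`Ix 1 = Fin (dim ℝ¹)`). [cite: Balaban1982Higgs1, (1.5) p.604] -/
def idxOne : Ix 1 := ⟨0, by
  have h : Module.finrank ℝ (E 1) = 1 := finrank_euclideanSpace_fin
  rw [h]; exact Nat.one_pos⟩

section Kernel

variable (Ω : Finset (HiggsLattice.Site P 0)) (msq a : ℝ) (k : ℕ)

/-- **The kernel of the `j`-th scale piece of the free scalar propagator on the region**, `G^η_{(j)}(Ω, 0; z, x′) =
ε^{−d}·[G^η_{(j)}(Ω,0)e_{x′}](z)` — the `(z, x′)` matrix element of r14's region piece `pieceR` of (2.6) at the trivial charge data and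
`A = 0`, in the kernel normalisation of (2.10) (`(Gf)(z) = Σ_{x′} ε^d G(z,x′)f(x′)`). [cite: Balaban1983Higgs3, (2.6) p.424, (2.10) p.426] -/
def scalarKerR (j : ℕ) (z x' : HiggsLattice.Site P 0) : ℝ :=
  (P.mesh 0 ^ P.d)⁻¹ * mat (pieceR chargeOne Ω (0 : HiggsLattice.VecField P 0) msq a k j) (z, idxOne) (x', idxOne)

variable {Ω msq a k}

/-- **The scalar kernel is dominated by r14's column quantity** `ε^{−d}Σ_{i′}‖[G^η_{(j)}(Ω,0)e_{(x′,i′)}](z)‖` (the `absG` field of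
`B3Ineq210RegularRegion.regRegionKernels` at `(chargeOne, A = 0)`). [cite: Balaban1983Higgs3, (2.10) p.426] -/
theorem abs_scalarKerR_le (j : ℕ) (z x' : HiggsLattice.Site P 0) :
    |scalarKerR Ω msq a k j z x'|
      ≤ (P.mesh 0 ^ P.d)⁻¹ * ∑ i' : Ix 1, ‖pieceR chargeOne Ω (0 : HiggsLattice.VecField P 0) msq a k j (cb P 1 0 (x', i')) z‖ := by
  unfold scalarKerR
  have hpos : 0 < (P.mesh 0 ^ P.d)⁻¹ := inv_pos.mpr (pow_pos (P.mesh_pos 0) _)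
  rw [abs_mul, abs_of_pos hpos]
  refine mul_le_mul_of_nonneg_left ?_ hpos.le
  calc |mat (pieceR chargeOne Ω (0 : HiggsLattice.VecField P 0) msq a k j) (z, idxOne) (x', idxOne)|
      ≤ ‖pieceR chargeOne Ω (0 : HiggsLattice.VecField P 0) msq a k j (cb P 1 0 (x', idxOne)) z‖ :=
        abs_mat_le_norm _ (z, idxOne) (x', idxOne)
    _ ≤ ∑ i' : Ix 1, ‖pieceR chargeOne Ω (0 : HiggsLattice.VecField P 0) msq a k j (cb P 1 0 (x', i')) z‖ :=
        Finset.single_le_sum (f := fun i' => ‖pieceR chargeOne Ω (0 : HiggsLattice.VecField P 0) msq a k j (cb P 1 0 (x', i')) z‖)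
          (fun i _ => norm_nonneg _) (Finset.mem_univ idxOne)

/-- **No pieces beyond `j = k − 1`** ((2.6) has `k` terms): the kernel of `G^η_{(j)}` vanishes for `1 ≤ j`, `k ≤ j`.
[cite: Balaban1983Higgs3, (2.6) p.424] -/
theorem scalarKerR_of_le {j : ℕ} (hj1 : 1 ≤ j) (hkj : k ≤ j) (z x' : HiggsLattice.Site P 0) :
    scalarKerR Ω msq a k j z x' = 0 := by
  unfold scalarKerR
  rw [pieceR_of_le hj1 hkj]
  simp [mat]

end Kernel

/-! ## §2 The (2.12) objects: the bond kernel, the leg averaged along `Γ^{(j+1)}_{x_{j+1},x}`, `dist(B^j(x), b)` -/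

section Objects

variable (Ω : Finset (HiggsLattice.Site P 0)) (msq a : ℝ) (k : ℕ)

/-- **The `j`-th scale piece of the vector-field propagator between two bonds** `b′ = ⟨z, z + εe_ν⟩`, `b = ⟨x_b, x_b + εe_μ⟩` at zero
background: `δ_{νμ}·G^η_{(j)}(Ω, 0; z, x_b)` — the `d` components of the vector field are independent copies of the free scalar field
([B1] p. 608 «N = d and an external vector field A = 0»). [cite: Balaban1983Higgs3, (2.12) p.426] [cite: Balaban1982Higgs1, p.608] -/
def vecPieceR (j : ℕ) (b' b : HiggsLattice.PBond P 0) : ℝ :=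
  if b'.dir = b.dir then scalarKerR Ω msq a k j b'.src b.src else 0

/-- **`G^η_{(j)}(Γ^{(j+1)}_{x_{j+1},x}, b) = Σ_{b′⊂Γ^{(j+1)}_{x_{j+1},x}} η·G^η_{(j)}(b′, b)`**: the leg `A′^{(j),η}(Γ^{(j+1)}_{x_{j+1},x}) =
Σ_{b′⊂Γ}ηA′_{b′}` of (1.3) contracted with `A′_b` in the `j`-th scale piece — the composite contour of [B1] (2.2) from the corner
`x_{j+1}` of the `(j+1)`-block of `x` to `x`, summed by `HiggsAveraging.multiContourSum`. [cite: Balaban1983Higgs3, (1.3) p.412, (2.12) p.426]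
[cite: Balaban1982Higgs1, (2.2)–(2.3) p.608] -/
def gsumR (j : ℕ) (x : HiggsLattice.Site P 0) (b : HiggsLattice.PBond P 0) : ℝ :=
  multiContourSum (fun b' => P.mesh 0 * vecPieceR Ω msq a k j b' b) (j + 1) x

/-- The block `B^j(x) = B^j(x_j) ⊂ T_ε` containing `x` ([B1] (1.20)). [cite: Balaban1982Higgs1, (1.20) p.607] -/
def blockSitesR (j : ℕ) (x : HiggsLattice.Site P 0) : Finset (HiggsLattice.Site P 0) := blockK j (blockIter j x)

/-- `x ∈ B^j(x)`. [cite: Balaban1982Higgs1, (1.20) p.607] -/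
theorem mem_blockSitesR (j : ℕ) (x : HiggsLattice.Site P 0) : x ∈ blockSitesR (P := P) j x :=
  (mem_blockK _ _ _).2 rfl

/-- `B^j(x)` is nonempty. [cite: Balaban1982Higgs1, (1.20) p.607] -/
theorem blockSitesR_nonempty (j : ℕ) (x : HiggsLattice.Site P 0) : (blockSitesR (P := P) j x).Nonempty :=
  ⟨x, mem_blockSitesR j x⟩

/-- **`dist(B^j(x), b)`** of (2.12), in physical units: `η·min_{z ∈ B^j(x)} min(|z − x_b|, |z − (x_b + εe_μ)|)` with the torus
distance (I.1.3) in lattice units (the print does not fix the norm). [cite: Balaban1983Higgs3, (2.12) p.426] [cite: Balaban1982Higgs1, (1.3) p.604] -/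
def distBlockR (j : ℕ) (x : HiggsLattice.Site P 0) (b : HiggsLattice.PBond P 0) : ℝ :=
  P.mesh 0 * (((blockSitesR j x).inf' (blockSitesR_nonempty j x)
    fun z => min (HiggsLattice.Site.tdist z b.src) (HiggsLattice.Site.tdist z b.tgt) : ℕ) : ℝ)

variable {Ω msq a k}

/-- **`dist(B^j(x), b) ≤ η|x − x_b|`** (`x ∈ B^j(x)`): the only property of the block distance used. [cite: Balaban1983Higgs3, (2.12) p.426] -/
theorem distBlockR_le (j : ℕ) (x : HiggsLattice.Site P 0) (b : HiggsLattice.PBond P 0) :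
    distBlockR (P := P) j x b ≤ P.mesh 0 * (HiggsLattice.Site.tdist x b.src : ℝ) := by
  unfold distBlockR
  refine mul_le_mul_of_nonneg_left ?_ (P.mesh_pos 0).le
  have h : (blockSitesR j x).inf' (blockSitesR_nonempty j x)
      (fun z => min (HiggsLattice.Site.tdist z b.src) (HiggsLattice.Site.tdist z b.tgt)) ≤ HiggsLattice.Site.tdist x b.src :=
    (Finset.inf'_le _ (mem_blockSitesR j x)).trans (min_le_left _ _)
  exact_mod_cast h

/-- `dist(B^j(x), b) ≥ 0`. [cite: Balaban1983Higgs3, (2.12) p.426] -/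
theorem distBlockR_nonneg (j : ℕ) (x : HiggsLattice.Site P 0) (b : HiggsLattice.PBond P 0) : 0 ≤ distBlockR (P := P) j x b := by
  unfold distBlockR
  exact mul_nonneg (P.mesh_pos 0).le (Nat.cast_nonneg _)

/-- For `1 ≤ k ≤ j` the averaged leg vanishes with the piece. [cite: Balaban1983Higgs3, (2.6) p.424, (2.12) p.426] -/
theorem gsumR_of_le {j : ℕ} (hk1 : 1 ≤ k) (hkj : k ≤ j) (x : HiggsLattice.Site P 0) (b : HiggsLattice.PBond P 0) :
    gsumR Ω msq a k j x b = 0 := by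
  unfold gsumR
  have h : (fun b' : HiggsLattice.PBond P 0 => P.mesh 0 * vecPieceR Ω msq a k j b' b) = (0 : HiggsLattice.VecField P 0) := by
    funext b'
    simp [vecPieceR, scalarKerR_of_le (Ω := Ω) (msq := msq) (a := a) (hk1.trans hkj) hkj]
  rw [h, multiContourSum_zero_field]

end Objects

/-! ## §3 Interior points whose whole block is interior, the carrier, the case `Ω = T_ε` -/

section CarrierV

variable {k K₀ : ℕ} {Ω : Finset (HiggsLattice.Site P 0)}

/-- **Sites whose whole `k`-block is interior**: every point `z` of the `k`-block `B^k(x_k) ∋ x` carries r14's interior margin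
(`Interior k K₀ Ω z`: the lattice ball of radius `2r_S + 2L^kK₀(d+1) + 1` around `z` lies in `Ω`) — so every point of the contours
`Γ^{(j+1)}_{x_{j+1},x} ⊂ B^{j+1}(x_{j+1}) ⊂ B^k(x_k)`, `j < k`, satisfies Proposition I.2.1's clause «dist({x,x′}, Ωᶜ) ≥ R₀».
[cite: Balaban1982Higgs1, Prop. 2.1 p.610, (2.2) p.608] -/
def InteriorK (k K₀ : ℕ) (Ω : Finset (HiggsLattice.Site P 0)) (x : HiggsLattice.Site P 0) : Prop :=
  ∀ z : HiggsLattice.Site P 0, blockIter k z = blockIter k x → Interior k K₀ Ω z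

/-- A site whose block is interior is interior. [cite: Balaban1982Higgs1, Prop. 2.1 p.610] -/
theorem InteriorK.self {x : HiggsLattice.Site P 0} (hx : InteriorK k K₀ Ω x) : Interior k K₀ Ω x := hx x rfl

/-- For `Ω = T_ε` every site is interior (r14's `interior_univ`, restated for the dot-free use below). [cite: Balaban1982Higgs1, Prop. 2.1 p.610] -/
theorem interior_univ' (x : HiggsLattice.Site P 0) : Interior k K₀ (Finset.univ : Finset (HiggsLattice.Site P 0)) x :=
  fun y _ => Finset.mem_univ y

/-- For `Ω = T_ε` every site has an interior block. [cite: Balaban1982Higgs1, Prop. 2.1 p.610] -/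
theorem interiorK_univ (x : HiggsLattice.Site P 0) : InteriorK k K₀ (Finset.univ : Finset (HiggsLattice.Site P 0)) x :=
  fun z _ => interior_univ' z

end CarrierV

/-- **The concrete carrier of B3 (2.12) (and (2.10)) on a REGION `Ω ⊆ T_η` at zero background**: sites = the points of `Ω` whose
`k`-block carries the interior margin (`InteriorK`), bonds = the bonds of `T_ε` whose initial point carries it (`Interior`);
`dist = ε|x − x′|`; `absG`, `absDG` = r14's region kernels of the pieces (2.6) at the trivial charge data and `A = 0` (the free scalar
field); `absGavg j x b = |G^η_{(j)}(Γ^{(j+1)}_{x_{j+1},x}, b)|` (`gsumR`), `distBlock j x b = η·dist(B^j(x), b)` (`distBlockR`); the fields of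
(2.5), (2.11) are not modelled (`0`). [cite: Balaban1983Higgs3, (2.6) p.424, (2.10)–(2.12) p.426] [cite: Balaban1982Higgs1, Prop. 2.1 p.610] -/
def zeroRegionKernelsV {P : HiggsLattice.Params} (hL1 : 1 < P.L) (Ω : Finset (HiggsLattice.Site P 0)) (msq a : ℝ) (k K₀ : ℕ) :
    ScaledKernels where
  Site := {x : HiggsLattice.Site P 0 // InteriorK k K₀ Ω x}
  Bond := {b : HiggsLattice.PBond P 0 // Interior k K₀ Ω b.src}
  Dir := Fin P.d
  LocFn := PUnit
  dist := fun x x' => P.mesh 0 * (HiggsLattice.Site.tdist x.1 x'.1 : ℝ)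
  dist2 := fun _ _ _ => 0
  distBlock := fun j x b => distBlockR j x.1 b.1
  distSupp := fun _ _ => 0
  distΩ₂ := 0
  L := P.L
  η := P.mesh 0
  d := P.d
  eRun := 0
  pRun := 0
  one_lt_L := by exact_mod_cast hL1
  η_pos := P.mesh_pos 0
  absG := fun j x x' => (P.mesh 0 ^ P.d)⁻¹ *
    ∑ i' : Ix 1, ‖pieceR chargeOne Ω (0 : HiggsLattice.VecField P 0) msq a k j (cb P 1 0 (x'.1, i')) x.1‖
  absDG := fun j μ x x' => (P.mesh 0 ^ P.d)⁻¹ *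
    ∑ i' : Ix 1, ‖covDeriv chargeOne (0 : HiggsLattice.VecField P 0) (pieceR chargeOne Ω (0 : HiggsLattice.VecField P 0) msq a k j (cb P 1 0 (x'.1, i')))
      ⟨x.1, μ⟩‖
  holderDiff := fun _ _ _ _ _ => 0
  absGavg := fun j x b => |gsumR Ω msq a k j x.1 b.1|
  normDeltaG := fun _ _ _ => 0
  norm116 := fun _ _ _ _ _ => 0

section CarrierV2

variable {hL1 : 1 < P.L} {Ω : Finset (HiggsLattice.Site P 0)} {msq a : ℝ} {k K₀ : ℕ}

/-- the carrier's `L^jη` is the model's `L^jε`. [cite: Balaban1983Higgs3, (2.10) p.426] -/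
theorem scaleV_eq (j : ℕ) : (zeroRegionKernelsV hL1 Ω msq a k K₀).scale j = P.mesh j := by
  show (P.L : ℝ) ^ j * P.mesh 0 = P.mesh j
  rw [mesh_eq_pow_mul P j]

end CarrierV2

/-! ## §4 The engine: (2.10) at interior pairs ⇒ the bound on the averaged leg («an additional factor L^jη») -/

section Engine

variable {Ω : Finset (HiggsLattice.Site P 0)} {msq a : ℝ} {k K₀ : ℕ}

/-- kernel: a decay factor with a shorter distance, up to the length of the contour: if `|x − x_b| ≤ |x − z| + |z − x_b|` and
`|x − z| ≤ L^{j+1}`, then `e^{−δ₁(L^jε)^{−1}ε|z − x_b|} ≤ e^{δ₁L}·e^{−δ₁(L^jε)^{−1}ε|x − x_b|}`. [folklore] -/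
private theorem exp_shift_le {δ₁ txz tzy txy : ℝ} (hδ₁ : 0 ≤ δ₁) (j : ℕ) (htri : txy ≤ txz + tzy)
    (htxz : txz ≤ (P.L : ℝ) ^ (j + 1)) :
    Real.exp (-(δ₁ * (P.mesh j)⁻¹ * (P.mesh 0 * tzy)))
      ≤ Real.exp (δ₁ * P.L) * Real.exp (-(δ₁ * (P.mesh j)⁻¹ * (P.mesh 0 * txy))) := by
  rw [← Real.exp_add]
  apply Real.exp_le_exp.mpr
  have hm : 0 < P.mesh j := P.mesh_pos j
  have hε : 0 < P.mesh 0 := P.mesh_pos 0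
  have hL : (0 : ℝ) < P.L := by exact_mod_cast P.hL
  have hc : 0 ≤ δ₁ * (P.mesh j)⁻¹ * P.mesh 0 := mul_nonneg (mul_nonneg hδ₁ (inv_nonneg.mpr hm.le)) hε.le
  have hkey : δ₁ * (P.mesh j)⁻¹ * P.mesh 0 * (P.L : ℝ) ^ (j + 1) = δ₁ * P.L := by
    have hne : (P.L : ℝ) ^ j * P.mesh 0 ≠ 0 := mul_ne_zero (pow_ne_zero _ hL.ne') hε.ne'
    rw [mesh_eq_pow_mul P j, pow_succ]
    calc δ₁ * ((P.L : ℝ) ^ j * P.mesh 0)⁻¹ * P.mesh 0 * ((P.L : ℝ) ^ j * P.L)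
        = δ₁ * P.L * (((P.L : ℝ) ^ j * P.mesh 0)⁻¹ * ((P.L : ℝ) ^ j * P.mesh 0)) := by ring
      _ = δ₁ * P.L := by rw [inv_mul_cancel₀ hne, mul_one]
  have h1 : δ₁ * (P.mesh j)⁻¹ * (P.mesh 0 * txy) ≤ δ₁ * (P.mesh j)⁻¹ * (P.mesh 0 * tzy) + δ₁ * P.L := by
    calc δ₁ * (P.mesh j)⁻¹ * (P.mesh 0 * txy)
        = δ₁ * (P.mesh j)⁻¹ * P.mesh 0 * txy := by ring
      _ ≤ δ₁ * (P.mesh j)⁻¹ * P.mesh 0 * (txz + tzy) := mul_le_mul_of_nonneg_left htri hc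
      _ = δ₁ * (P.mesh j)⁻¹ * P.mesh 0 * txz + δ₁ * (P.mesh j)⁻¹ * (P.mesh 0 * tzy) := by ring
      _ ≤ δ₁ * (P.mesh j)⁻¹ * P.mesh 0 * (P.L : ℝ) ^ (j + 1) + δ₁ * (P.mesh j)⁻¹ * (P.mesh 0 * tzy) := by
          have := mul_le_mul_of_nonneg_left htxz hc
          linarith
      _ = δ₁ * (P.mesh j)⁻¹ * (P.mesh 0 * tzy) + δ₁ * P.L := by rw [hkey]; ring
  linarith

/-- kernel: `(L^jε)^{3−d} = L^jε·(L^jε)^{2−d}`. [folklore] -/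
private theorem rpow_three_sub (j : ℕ) :
    P.mesh j ^ ((3 : ℝ) - (P.d : ℝ)) = P.mesh j * P.mesh j ^ ((2 : ℝ) - (P.d : ℝ)) := by
  have hm : 0 < P.mesh j := P.mesh_pos j
  rw [show (3 : ℝ) - (P.d : ℝ) = 1 + ((2 : ℝ) - (P.d : ℝ)) by ring, Real.rpow_add hm, Real.rpow_one]

/-- **THE ENGINE — (2.12) from (2.10) at interior pairs.**  If the kernels of the pieces `G^η_{(j)}(Ω, 0)` obey (2.10) at every pair
of interior points (hypothesis `h210`, the conclusion of r14's `ineq210_regularRegion_explicit` at `(chargeOne, A = 0)`), then for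
every site `x` whose `k`-block is interior and every bond `b` with interior initial point,
`|G^η_{(j)}(Γ^{(j+1)}_{x_{j+1},x}, b)| ≤ d·L·e^{δ₁L}·C·(L^jη)^{3−d}·e^{−δ₁(L^jη)^{−1}η|x − x_b|}`: the contour has at most `d(L^{j+1} − 1)` bonds
(`sum_steps_le`), each of weight `η`, each starting in the `(j+1)`-block of `x` (`blockIter_stair_src`; hence interior, and within
`L^{j+1} − 1` of `x`, `tdist_le_of_blockIter_eq_real`), and carrying the pointwise bound (2.10) — the print's «additional factor L^jη».
Pieces `j ≥ k` vanish. [cite: Balaban1983Higgs3, (2.10) p.426, (2.12) p.426] [cite: Balaban1982Higgs1, (2.2) p.608, Prop. 2.1 p.610] -/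
theorem abs_gsumR_le (hk1 : 1 ≤ k) (hkK : k ≤ P.K) {δ₁ Cst : ℝ} (hδ₁ : 0 ≤ δ₁) (hCst : 0 ≤ Cst)
    (h210 : ∀ (j : ℕ) (z x' : HiggsLattice.Site P 0), Interior k K₀ Ω z → Interior k K₀ Ω x' →
      (P.mesh 0 ^ P.d)⁻¹ * ∑ i' : Ix 1, ‖pieceR chargeOne Ω (0 : HiggsLattice.VecField P 0) msq a k j (cb P 1 0 (x', i')) z‖
        ≤ Cst * P.mesh j ^ ((2 : ℝ) - (P.d : ℝ)) *
          Real.exp (-(δ₁ * (P.mesh j)⁻¹ * (P.mesh 0 * (HiggsLattice.Site.tdist z x' : ℝ)))))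
    (j : ℕ) {x : HiggsLattice.Site P 0} (hx : InteriorK k K₀ Ω x) {b : HiggsLattice.PBond P 0} (hb : Interior k K₀ Ω b.src) :
    |gsumR Ω msq a k j x b|
      ≤ (P.d * P.L * Real.exp (δ₁ * P.L) * Cst) * P.mesh j ^ ((3 : ℝ) - (P.d : ℝ)) *
          Real.exp (-(δ₁ * (P.mesh j)⁻¹ * (P.mesh 0 * (HiggsLattice.Site.tdist x b.src : ℝ)))) := by
  have hm : 0 < P.mesh j := P.mesh_pos j
  have hε : 0 < P.mesh 0 := P.mesh_pos 0
  have hL : (0 : ℝ) < P.L := by exact_mod_cast P.hL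
  have hd : (0 : ℝ) ≤ P.d := Nat.cast_nonneg _
  -- the right side is nonnegative
  have hR : 0 ≤ (P.d * P.L * Real.exp (δ₁ * P.L) * Cst) * P.mesh j ^ ((3 : ℝ) - (P.d : ℝ)) *
      Real.exp (-(δ₁ * (P.mesh j)⁻¹ * (P.mesh 0 * (HiggsLattice.Site.tdist x b.src : ℝ)))) :=
    mul_nonneg (mul_nonneg (mul_nonneg (mul_nonneg (mul_nonneg hd hL.le) (Real.exp_pos _).le) hCst)
      (Real.rpow_nonneg hm.le _)) (Real.exp_pos _).le
  by_cases hjk : j < k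
  swap
  · -- no piece `j ≥ k`
    rw [gsumR_of_le hk1 (not_lt.mp hjk) x b, abs_zero]
    exact hR
  -- `j < k`: the contour `Γ^{(j+1)}_{x_{j+1},x}` is available (`j + 1 ≤ k ≤ K`)
  have hj1K : j + 1 ≤ P.K := by omega
  -- the uniform bound on one term of the contour sum
  set β : ℝ := P.mesh 0 * (Cst * P.mesh j ^ ((2 : ℝ) - (P.d : ℝ)) * (Real.exp (δ₁ * P.L) *
    Real.exp (-(δ₁ * (P.mesh j)⁻¹ * (P.mesh 0 * (HiggsLattice.Site.tdist x b.src : ℝ)))))) with hβ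
  have hβ0 : 0 ≤ β :=
    mul_nonneg hε.le (mul_nonneg (mul_nonneg hCst (Real.rpow_nonneg hm.le _))
      (mul_nonneg (Real.exp_pos _).le (Real.exp_pos _).le))
  have hB : ∀ i, i < j + 1 → ∀ (ν : Fin P.d) (s : ℕ),
      s < ((toFinest (blockIter i x)) ν - (toFinest (blockIter (i + 1) x)) ν).val →
      |(fun b' : HiggsLattice.PBond P 0 => P.mesh 0 * vecPieceR Ω msq a k j b' b)
        ⟨shiftN (cornerN (toFinest (blockIter (i + 1) x)) (toFinest (blockIter i x)) (ν + 1)) ν s, ν⟩| ≤ β := by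
    intro i hi ν s hs
    -- the base point lies in the `k`-block and in the `(j+1)`-block of `x`
    have hzk := blockIter_stair_src (k := k) (show i < k by omega) hkK x ν hs
    have hzj := blockIter_stair_src (k := j + 1) (show i < j + 1 by omega) hj1K x ν hs
    generalize shiftN (cornerN (toFinest (blockIter (i + 1) x)) (toFinest (blockIter i x)) (ν + 1)) ν s = z at hzk hzj ⊢
    have hzI : Interior k K₀ Ω z := hx z hzk
    have hxz : (HiggsLattice.Site.tdist x z : ℝ) ≤ (P.L : ℝ) ^ (j + 1) :=
      (tdist_le_of_blockIter_eq_real hj1K hzj.symm).trans (by linarith)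
    have htri : (HiggsLattice.Site.tdist x b.src : ℝ)
        ≤ (HiggsLattice.Site.tdist x z : ℝ) + (HiggsLattice.Site.tdist z b.src : ℝ) := tdist_triangle_real x z b.src
    show |P.mesh 0 * vecPieceR Ω msq a k j ⟨z, ν⟩ b| ≤ β
    rw [abs_mul, abs_of_pos hε, hβ]
    refine mul_le_mul_of_nonneg_left ?_ hε.le
    unfold vecPieceR
    split_ifs with hdir
    · calc |scalarKerR Ω msq a k j z b.src|
          ≤ (P.mesh 0 ^ P.d)⁻¹ *
              ∑ i' : Ix 1, ‖pieceR chargeOne Ω (0 : HiggsLattice.VecField P 0) msq a k j (cb P 1 0 (b.src, i')) z‖ :=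
            abs_scalarKerR_le j z b.src
        _ ≤ Cst * P.mesh j ^ ((2 : ℝ) - (P.d : ℝ)) *
              Real.exp (-(δ₁ * (P.mesh j)⁻¹ * (P.mesh 0 * (HiggsLattice.Site.tdist z b.src : ℝ)))) :=
            h210 j z b.src hzI hb
        _ ≤ Cst * P.mesh j ^ ((2 : ℝ) - (P.d : ℝ)) * (Real.exp (δ₁ * P.L) *
              Real.exp (-(δ₁ * (P.mesh j)⁻¹ * (P.mesh 0 * (HiggsLattice.Site.tdist x b.src : ℝ))))) :=
            mul_le_mul_of_nonneg_left (exp_shift_le hδ₁ j htri hxz) (mul_nonneg hCst (Real.rpow_nonneg hm.le _))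
    · rw [abs_zero]
      exact mul_nonneg (mul_nonneg hCst (Real.rpow_nonneg hm.le _)) (mul_nonneg (Real.exp_pos _).le (Real.exp_pos _).le)
  -- the contour bound and the length of the contour
  have hsum := abs_multiContourSum_le (fun b' : HiggsLattice.PBond P 0 => P.mesh 0 * vecPieceR Ω msq a k j b' b) (j + 1) x hB
  have hlen := sum_steps_le hj1K x
  have hlen' : (∑ i ∈ Finset.range (j + 1), ∑ ν : Fin P.d,
      (((toFinest (blockIter i x)) ν - (toFinest (blockIter (i + 1) x)) ν).val : ℝ)) ≤ P.d * (P.L : ℝ) ^ (j + 1) := by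
    refine hlen.trans ?_
    have : (P.L : ℝ) ^ (j + 1) - 1 ≤ (P.L : ℝ) ^ (j + 1) := by linarith
    exact mul_le_mul_of_nonneg_left this hd
  unfold gsumR
  calc |multiContourSum (fun b' : HiggsLattice.PBond P 0 => P.mesh 0 * vecPieceR Ω msq a k j b' b) (j + 1) x|
      ≤ (∑ i ∈ Finset.range (j + 1), ∑ ν : Fin P.d,
          (((toFinest (blockIter i x)) ν - (toFinest (blockIter (i + 1) x)) ν).val : ℝ)) * β := hsum
    _ ≤ (P.d * (P.L : ℝ) ^ (j + 1)) * β := mul_le_mul_of_nonneg_right hlen' hβ0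
    _ = (P.d * P.L * Real.exp (δ₁ * P.L) * Cst) * P.mesh j ^ ((3 : ℝ) - (P.d : ℝ)) *
          Real.exp (-(δ₁ * (P.mesh j)⁻¹ * (P.mesh 0 * (HiggsLattice.Site.tdist x b.src : ℝ)))) := by
        rw [hβ, rpow_three_sub, mesh_eq_pow_mul P j, pow_succ]
        ring

end Engine

/-! ## §5 (2.12) PROVED on a region at zero background; (2.10) for the same carrier -/

section Main

/-- **B3 (2.12) ON A REGION `Ω ⊆ T_η` (a union of big blocks) AT ZERO BACKGROUND — `Ineq212` DISCHARGED.**  For `d ≥ 1`, `L ≥ 2`,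
`a > 0`, `m² > 0` there is `K₀,min` such that for every cube size `K₀ ≥ K₀,min` there are `δ₁, C > 0` (depending on `d, L, a, m², K₀`
only) with: for EVERY volume `P` with these `d, L` and `K₀ ∣ M`, every scale `1 ≤ k ≤ K` with `L^kε ≤ 1` and at least three cubes a
side, and every big-block union `Ω`, the carrier `zeroRegionKernelsV … Ω m² a k K₀` satisfies
`|G^η_{(j)}(Γ^{(j+1)}_{x_{j+1},x}, b)| ≤ C(L^jη)^{−d+3}e^{−δ₁(L^jη)^{−1}dist(B^j(x),b)}` for all `j`, all sites `x` with interior `k`-block and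
all bonds `b` with interior initial point.  Route = the print's «additional factor L^jη» over (2.10) on regions
(`B3Ineq210RegularRegion.ineq210_regularRegion_explicit`, BY NAME, at the trivial charge data and `A = 0`).
[cite: Balaban1983Higgs3, (2.12) p.426] [cite: Balaban1982Higgs1, (2.2) p.608, Prop. 2.1 p.610] -/
theorem ineq212_zeroRegion (d L : ℕ) (hd : 1 ≤ d) (hL : 2 ≤ L) {a : ℝ} (ha : 0 < a) {msq : ℝ} (hmsq : 0 < msq) :
    ∃ K₀min : ℕ, ∀ K₀ : ℕ, K₀min ≤ K₀ → ∃ δ₁ Cst : ℝ, 0 < δ₁ ∧ 0 < Cst ∧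
      ∀ (P : HiggsLattice.Params) (hP1 : 1 < P.L), P.d = d → P.L = L → K₀ ∣ P.M →
      ∀ {k : ℕ}, 1 ≤ k → k ≤ P.K → (∀ μ, 3 * half P k K₀ ≤ P.sitesPerDir 0 μ) → P.mesh k ≤ 1 →
      ∀ (Ω : Finset (HiggsLattice.Site P 0)), IsBigBlockUnion k K₀ Ω →
        (zeroRegionKernelsV hP1 Ω msq a k K₀).Ineq212 δ₁ Cst := by
  obtain ⟨E₀, hE₀, h⟩ := ineq210_regularRegion_explicit d L hd hL ha hmsq (c := 0) le_rfl 1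
  obtain ⟨K₀min, h⟩ := h chargeOne (by rw [chargeOne_e]; simpa using hE₀.le)
  refine ⟨K₀min, fun K₀ hK₀ => ?_⟩
  obtain ⟨t, δ₁, Cst, ht, hδ₁, hCst, h⟩ := h K₀ hK₀
  have hL0 : (0 : ℝ) < L := by exact_mod_cast (show 0 < L by omega)
  have hd0 : (0 : ℝ) < d := by exact_mod_cast (show 0 < d by omega)
  refine ⟨δ₁, d * L * Real.exp (δ₁ * L) * Cst, hδ₁,
    mul_pos (mul_pos (mul_pos hd0 hL0) (Real.exp_pos _)) hCst, ?_⟩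
  intro P hP1 hPd hPL hK₀M k hk1 hkK h3 hmesh Ω hΩ
  -- (2.10) at interior pairs, at the trivial charge data and `A = 0`
  have h210 : ∀ (j : ℕ) (z x' : HiggsLattice.Site P 0), Interior k K₀ Ω z → Interior k K₀ Ω x' →
      (P.mesh 0 ^ P.d)⁻¹ * ∑ i' : Ix 1, ‖pieceR chargeOne Ω (0 : HiggsLattice.VecField P 0) msq a k j (cb P 1 0 (x', i')) z‖
        ≤ Cst * P.mesh j ^ ((2 : ℝ) - (P.d : ℝ)) *
          Real.exp (-(δ₁ * (P.mesh j)⁻¹ * (P.mesh 0 * (HiggsLattice.Site.tdist z x' : ℝ)))) :=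
    fun j z x' hz hx' => (h P hP1 hPd hPL hK₀M hk1 hkK h3 hmesh Ω hΩ (0 : HiggsLattice.VecField P 0) (δA := 0) le_rfl
      (fun z _ μ ν => by simp) (by rw [chargeOne_e]; simpa using ht.le) (by rw [chargeOne_e]; simp) j z x' hz hx').1
  intro j x b
  have hmain := abs_gsumR_le (Ω := Ω) (msq := msq) (a := a) (K₀ := K₀) hk1 hkK hδ₁.le hCst.le h210 j x.2 b.2
  rw [scaleV_eq]
  dsimp only [zeroRegionKernelsV]
  -- the constant of the statement is the engine's, read through `P.d = d`, `P.L = L`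
  have hcd : (d : ℝ) = (P.d : ℝ) := by rw [hPd]
  have hcL : (L : ℝ) = (P.L : ℝ) := by rw [hPL]
  rw [hcd, hcL]
  refine hmain.trans (mul_le_mul_of_nonneg_left ?_ ?_)
  · apply Real.exp_le_exp.mpr
    have hc : 0 ≤ δ₁ * (P.mesh j)⁻¹ := mul_nonneg hδ₁.le (inv_nonneg.mpr (P.mesh_pos j).le)
    have := mul_le_mul_of_nonneg_left (distBlockR_le j x.1 b.1) hc
    linarith
  · have hL0' : (0 : ℝ) ≤ P.L := by exact_mod_cast P.hL.le
    exact mul_nonneg (mul_nonneg (mul_nonneg (mul_nonneg (Nat.cast_nonneg _) hL0') (Real.exp_pos _).le) hCst.le)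
      (Real.rpow_nonneg (P.mesh_pos j).le _)

/-- **B3 (2.10) for the same carrier** (the free scalar pieces of the region operators at interior points): r14's
`ineq210_regularRegion_explicit` at the trivial charge data and `A = 0`, read on `zeroRegionKernelsV`.
[cite: Balaban1983Higgs3, (2.10) p.426] [cite: Balaban1982Higgs1, Prop. 2.1 p.610] -/
theorem ineq210_zeroRegion (d L : ℕ) (hd : 1 ≤ d) (hL : 2 ≤ L) {a : ℝ} (ha : 0 < a) {msq : ℝ} (hmsq : 0 < msq) :
    ∃ K₀min : ℕ, ∀ K₀ : ℕ, K₀min ≤ K₀ → ∃ δ₁ Cst : ℝ, 0 < δ₁ ∧ 0 < Cst ∧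
      ∀ (P : HiggsLattice.Params) (hP1 : 1 < P.L), P.d = d → P.L = L → K₀ ∣ P.M →
      ∀ {k : ℕ}, 1 ≤ k → k ≤ P.K → (∀ μ, 3 * half P k K₀ ≤ P.sitesPerDir 0 μ) → P.mesh k ≤ 1 →
      ∀ (Ω : Finset (HiggsLattice.Site P 0)), IsBigBlockUnion k K₀ Ω →
        (zeroRegionKernelsV hP1 Ω msq a k K₀).Ineq210 δ₁ Cst := by
  obtain ⟨E₀, hE₀, h⟩ := ineq210_regularRegion_explicit d L hd hL ha hmsq (c := 0) le_rfl 1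
  obtain ⟨K₀min, h⟩ := h chargeOne (by rw [chargeOne_e]; simpa using hE₀.le)
  refine ⟨K₀min, fun K₀ hK₀ => ?_⟩
  obtain ⟨t, δ₁, Cst, ht, hδ₁, hCst, h⟩ := h K₀ hK₀
  refine ⟨δ₁, Cst, hδ₁, hCst, ?_⟩
  intro P hP1 hPd hPL hK₀M k hk1 hkK h3 hmesh Ω hΩ j x x'
  have h' := h P hP1 hPd hPL hK₀M hk1 hkK h3 hmesh Ω hΩ (0 : HiggsLattice.VecField P 0) (δA := 0) le_rfl
    (fun z _ μ ν => by simp) (by rw [chargeOne_e]; simpa using ht.le) (by rw [chargeOne_e]; simp) j x.1 x'.1 x.2.self x'.2.self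
  rw [scaleV_eq]
  dsimp only [zeroRegionKernelsV]
  exact h'

/-- The carrier's distances are nonnegative. [cite: Balaban1982Higgs1, (1.3) p.604] -/
theorem distV_nonneg {hL1 : 1 < P.L} {Ω : Finset (HiggsLattice.Site P 0)} {msq a : ℝ} {k K₀ : ℕ}
    (x x' : (zeroRegionKernelsV hL1 Ω msq a k K₀).Site) : 0 ≤ (zeroRegionKernelsV hL1 Ω msq a k K₀).dist x x' := by
  dsimp only [zeroRegionKernelsV]
  exact mul_nonneg (P.mesh_pos 0).le (Nat.cast_nonneg _)

/-- The carrier's block distances are nonnegative. [cite: Balaban1983Higgs3, (2.12) p.426] -/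
theorem distBlockV_nonneg {hL1 : 1 < P.L} {Ω : Finset (HiggsLattice.Site P 0)} {msq a : ℝ} {k K₀ : ℕ} (j : ℕ)
    (x : (zeroRegionKernelsV hL1 Ω msq a k K₀).Site) (b : (zeroRegionKernelsV hL1 Ω msq a k K₀).Bond) :
    0 ≤ (zeroRegionKernelsV hL1 Ω msq a k K₀).distBlock j x b := by
  dsimp only [zeroRegionKernelsV]
  exact distBlockR_nonneg j _ _

/-- The carrier's scales are positive. [cite: Balaban1983Higgs3, (2.10) p.426] -/
theorem scaleV_pos {hL1 : 1 < P.L} {Ω : Finset (HiggsLattice.Site P 0)} {msq a : ℝ} {k K₀ : ℕ} (j : ℕ) :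
    0 < (zeroRegionKernelsV hL1 Ω msq a k K₀).scale j := by
  rw [scaleV_eq]; exact P.mesh_pos j

/-- kernel: weakening the constant and the rate in the printed shape `C·s^e·e^{−δ s^{−1} D}`. [folklore] -/
private theorem weaken_shape {s e D δ δ' C C' : ℝ} (hs : 0 < s) (hD : 0 ≤ D) (hδ : δ' ≤ δ) (hC : 0 ≤ C) (hCle : C ≤ C') :
    C * s ^ e * Real.exp (-(δ * s⁻¹ * D)) ≤ C' * s ^ e * Real.exp (-(δ' * s⁻¹ * D)) := by
  have hpow : 0 ≤ s ^ e := Real.rpow_nonneg hs.le e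
  refine mul_le_mul (mul_le_mul_of_nonneg_right hCle hpow) ?_ (Real.exp_pos _).le (mul_nonneg (hC.trans hCle) hpow)
  apply Real.exp_le_exp.mpr
  have : δ' * s⁻¹ * D ≤ δ * s⁻¹ * D :=
    mul_le_mul_of_nonneg_right (mul_le_mul_of_nonneg_right hδ (inv_nonneg.mpr hs.le)) hD
  linarith

/-- **(2.10) and (2.12) together on the region carrier**, one cube threshold and one pair of constants.
[cite: Balaban1983Higgs3, (2.10) p.426, (2.12) p.426] -/
theorem ineq210_and_212_zeroRegion (d L : ℕ) (hd : 1 ≤ d) (hL : 2 ≤ L) {a : ℝ} (ha : 0 < a) {msq : ℝ} (hmsq : 0 < msq) :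
    ∃ K₀min : ℕ, ∀ K₀ : ℕ, K₀min ≤ K₀ → ∃ δ₁ Cst : ℝ, 0 < δ₁ ∧ 0 < Cst ∧
      ∀ (P : HiggsLattice.Params) (hP1 : 1 < P.L), P.d = d → P.L = L → K₀ ∣ P.M →
      ∀ {k : ℕ}, 1 ≤ k → k ≤ P.K → (∀ μ, 3 * half P k K₀ ≤ P.sitesPerDir 0 μ) → P.mesh k ≤ 1 →
      ∀ (Ω : Finset (HiggsLattice.Site P 0)), IsBigBlockUnion k K₀ Ω →
        (zeroRegionKernelsV hP1 Ω msq a k K₀).Ineq210 δ₁ Cst ∧ (zeroRegionKernelsV hP1 Ω msq a k K₀).Ineq212 δ₁ Cst := by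
  obtain ⟨K₁, h1⟩ := ineq210_zeroRegion d L hd hL ha hmsq
  obtain ⟨K₂, h2⟩ := ineq212_zeroRegion d L hd hL ha hmsq
  refine ⟨max K₁ K₂, fun K₀ hK₀ => ?_⟩
  obtain ⟨δ₁, C₁, hδ₁, hC₁, h1⟩ := h1 K₀ ((le_max_left _ _).trans hK₀)
  obtain ⟨δ₂, C₂, hδ₂, hC₂, h2⟩ := h2 K₀ ((le_max_right _ _).trans hK₀)
  refine ⟨min δ₁ δ₂, max C₁ C₂, lt_min hδ₁ hδ₂, lt_max_of_lt_left hC₁, ?_⟩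
  intro P hP1 hPd hPL hK₀M k hk1 hkK h3 hmesh Ω hΩ
  have h1' := h1 P hP1 hPd hPL hK₀M hk1 hkK h3 hmesh Ω hΩ
  have h2' := h2 P hP1 hPd hPL hK₀M hk1 hkK h3 hmesh Ω hΩ
  refine ⟨fun j x x' => ⟨?_, fun μ => ?_⟩, fun j x b => ?_⟩
  · exact ((h1' j x x').1).trans
      (weaken_shape (scaleV_pos j) (distV_nonneg x x') (min_le_left _ _) hC₁.le (le_max_left _ _))
  · exact ((h1' j x x').2 μ).trans
      (weaken_shape (scaleV_pos j) (distV_nonneg x x') (min_le_left _ _) hC₁.le (le_max_left _ _))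
  · exact (h2' j x b).trans
      (weaken_shape (scaleV_pos j) (distBlockV_nonneg j x b) (min_le_right _ _) hC₂.le (le_max_right _ _))

end Main

/-! ## §6 The full torus as a region: (2.12) at zero background for `Ω = T_ε`, every site and bond, every `L ≥ 2` -/

section Univ

/-- **(2.12) on the FULL torus `Ω = T_ε` at zero background, EVERY `L ≥ 2`**: the case `Ω = univ` of `ineq212_zeroRegion`
(`IsBigBlockUnion` holds for the whole torus, every site has an interior block, every bond an interior initial point —
`interiorK_univ`, `interior_univ'`).  Complements p03's odd-`L` torus member `B3Ineq212ZeroTorus.ineq212_zeroTorusV` on the [B4]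
lineage. [cite: Balaban1983Higgs3, (2.12) p.426] [cite: Balaban1982Higgs1, (2.2) p.608] -/
theorem ineq212_zeroRegion_univ (d L : ℕ) (hd : 1 ≤ d) (hL : 2 ≤ L) {a : ℝ} (ha : 0 < a) {msq : ℝ} (hmsq : 0 < msq) :
    ∃ K₀min : ℕ, ∀ K₀ : ℕ, K₀min ≤ K₀ → ∃ δ₁ Cst : ℝ, 0 < δ₁ ∧ 0 < Cst ∧
      ∀ (P : HiggsLattice.Params) (hP1 : 1 < P.L), P.d = d → P.L = L → K₀ ∣ P.M →
      ∀ {k : ℕ}, 1 ≤ k → k ≤ P.K → (∀ μ, 3 * half P k K₀ ≤ P.sitesPerDir 0 μ) → P.mesh k ≤ 1 →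
        (zeroRegionKernelsV hP1 (Finset.univ : Finset (HiggsLattice.Site P 0)) msq a k K₀).Ineq212 δ₁ Cst := by
  obtain ⟨K₀min, h⟩ := ineq212_zeroRegion d L hd hL ha hmsq
  refine ⟨K₀min, fun K₀ hK₀ => ?_⟩
  obtain ⟨δ₁, Cst, hδ₁, hCst, h⟩ := h K₀ hK₀
  exact ⟨δ₁, Cst, hδ₁, hCst, fun P hP1 hPd hPL hK₀M k hk1 hkK h3 hmesh =>
    h P hP1 hPd hPL hK₀M hk1 hkK h3 hmesh Finset.univ isBigBlockUnion_univ⟩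

/-- On the full torus the carrier's sites are ALL sites and its bonds ALL bonds (the interior predicates are trivially true):
the un-subtyped reading of `ineq212_zeroRegion_univ` — for every `x ∈ T_ε` and every bond `b`,
`|G^η_{(j)}(Γ^{(j+1)}_{x_{j+1},x}, b)| ≤ C(L^jε)^{3−d}e^{−δ₁(L^jε)^{−1}ε·dist(B^j(x),b)}`. [cite: Balaban1983Higgs3, (2.12) p.426] -/
theorem ineq212_zeroRegion_univ_explicit (d L : ℕ) (hd : 1 ≤ d) (hL : 2 ≤ L) {a : ℝ} (ha : 0 < a) {msq : ℝ} (hmsq : 0 < msq) :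
    ∃ K₀min : ℕ, ∀ K₀ : ℕ, K₀min ≤ K₀ → ∃ δ₁ Cst : ℝ, 0 < δ₁ ∧ 0 < Cst ∧
      ∀ (P : HiggsLattice.Params), 1 < P.L → P.d = d → P.L = L → K₀ ∣ P.M →
      ∀ {k : ℕ}, 1 ≤ k → k ≤ P.K → (∀ μ, 3 * half P k K₀ ≤ P.sitesPerDir 0 μ) → P.mesh k ≤ 1 →
      ∀ (j : ℕ) (x : HiggsLattice.Site P 0) (b : HiggsLattice.PBond P 0),
        |gsumR (Finset.univ : Finset (HiggsLattice.Site P 0)) msq a k j x b|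
          ≤ Cst * P.mesh j ^ ((3 : ℝ) - (P.d : ℝ)) *
            Real.exp (-(δ₁ * (P.mesh j)⁻¹ * distBlockR j x b)) := by
  obtain ⟨K₀min, h⟩ := ineq212_zeroRegion_univ d L hd hL ha hmsq
  refine ⟨K₀min, fun K₀ hK₀ => ?_⟩
  obtain ⟨δ₁, Cst, hδ₁, hCst, h⟩ := h K₀ hK₀
  refine ⟨δ₁, Cst, hδ₁, hCst, ?_⟩
  intro P hP1 hPd hPL hK₀M k hk1 hkK h3 hmesh j x b
  have h' := h P hP1 hPd hPL hK₀M hk1 hkK h3 hmesh j ⟨x, interiorK_univ x⟩ ⟨b, interior_univ' b.src⟩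
  rw [scaleV_eq] at h'
  dsimp only [zeroRegionKernelsV] at h'
  exact h'

end Univ

/-! ## §7 (v1.1, append-only) Non-vacuity with a PROPER region: sites with an interior block and interior bonds exist -/

section Nonvacuous

/-- kernel: a torus label within coordinate distance `ρ` of a base label `c ≥ ρ` (`c < n₀`) is at most `c + ρ` — no wrap-around
below. [folklore] -/
private theorem val_le_add_of_min_le {n₀ c ρ : ℕ} [NeZero n₀] (hc : c < n₀) (hρc : ρ ≤ c) {b : ZMod n₀}
    (h : min (((c : ℕ) : ZMod n₀) - b).val (b - ((c : ℕ) : ZMod n₀)).val ≤ ρ) : b.val ≤ c + ρ := by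
  have ha : (((c : ℕ) : ZMod n₀)).val = c := ZMod.val_cast_of_lt hc
  have hb : b.val < n₀ := ZMod.val_lt b
  rcases le_or_gt b.val c with hle | hlt
  · omega
  · have hba : (b - ((c : ℕ) : ZMod n₀)).val = b.val - c := by
      rw [ZMod.val_sub (by rw [ha]; exact hlt.le), ha]
    have hne : b - ((c : ℕ) : ZMod n₀) ≠ 0 := by
      intro h0
      have := congrArg ZMod.val h0
      rw [hba, ZMod.val_zero] at this
      omega
    have hab : (((c : ℕ) : ZMod n₀) - b).val = n₀ - (b.val - c) := by
      rw [← neg_sub, ZMod.neg_val, if_neg hne, hba]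
    rw [hab, hba] at h
    rcases min_le_iff.mp h with h1 | h1
    · omega
    · omega

/-- **Non-vacuity of the hypotheses of `ineq212_zeroRegion` / `ineq210_zeroRegion` with a PROPER region whose carrier is
inhabited.**  For `d ≥ 1`, `L ≥ 2` and every threshold `K₀,min` there are `K₀ ≥ K₀,min` and a volume `P` with these `d, L`, `K₀ ∣ M`,
`K = 1`, at scale `k = 1`: `3·half ≤ |T_ε|_μ` in every direction and `Lε ≤ 1`, together with a big-block union `Ω ≠ T_ε` (a slab of
cells) containing a site `x` WHOSE WHOLE BLOCK IS INTERIOR (`InteriorK 1 K₀ Ω x`, so `x` is a site of `zeroRegionKernelsV … Ω … 1 K₀`)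
and a bond with interior initial point (a bond of the carrier).  So the family of `ineq212_zeroRegion` contains proper regions with
inhabited carriers at every admissible cube size (the case `Ω = T_ε` is §6).  Same construction as r14's
`B3Ineq210RegularRegion.regularRegion_hypotheses_nonvacuous`, with the base point at a block corner `L·ρ₀` and a wider slab.
[cite: Balaban1983Higgs3, (2.12) p.426] [cite: Balaban1982Higgs1, (1.2) p.604, Prop. 2.1 p.610] -/
theorem zeroRegion_hypotheses_nonvacuous (d L : ℕ) (hd : 1 ≤ d) (hL : 2 ≤ L) (K₀min : ℕ) :
    ∃ K₀ : ℕ, K₀min ≤ K₀ ∧ ∃ (P : HiggsLattice.Params), 1 < P.L ∧ P.d = d ∧ P.L = L ∧ K₀ ∣ P.M ∧ 1 ≤ P.K ∧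
      (∀ μ, 3 * half P 1 K₀ ≤ P.sitesPerDir 0 μ) ∧ P.mesh 1 ≤ 1 ∧
      ∃ Ω : Finset (HiggsLattice.Site P 0), IsBigBlockUnion 1 K₀ Ω ∧ Ω ≠ Finset.univ ∧
        (∃ x, InteriorK 1 K₀ Ω x) ∧ (∃ b : HiggsLattice.PBond P 0, Interior 1 K₀ Ω b.src) := by
  have hL0 : 0 < L := by omega
  -- the cube size, the margin `ρ₀`, the slab width `n` (cells) and the volume
  obtain ⟨K₀, hK₀, hK₀1⟩ : ∃ K₀, K₀min ≤ K₀ ∧ 1 ≤ K₀ := ⟨max K₀min 1, le_max_left _ _, le_max_right _ _⟩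
  obtain ⟨ρ₀, hρ₀⟩ : ∃ ρ₀ : ℕ, ρ₀ = 2 * (5 * (L ^ 1 * K₀) / 8 + L ^ 1) + 2 * (L ^ 1 * K₀) * (d + 1) + 1 := ⟨_, rfl⟩
  obtain ⟨n, hn⟩ : ∃ n : ℕ, n = L * ρ₀ + L + ρ₀ := ⟨_, rfl⟩
  have hLK : 1 ≤ L * K₀ := Nat.one_le_iff_ne_zero.mpr (Nat.mul_ne_zero (by omega) (by omega))
  have hρ₀1 : 1 ≤ ρ₀ := by omega
  have hn3 : 3 ≤ n := by
    have : 2 * 1 ≤ L * ρ₀ := Nat.mul_le_mul hL hρ₀1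
    omega
  let P : HiggsLattice.Params :=
    ⟨d, ((L : ℝ))⁻¹, 1, L, K₀ * n, fun _ => 1, hd, by positivity, hL0, Nat.mul_pos (by omega) (by omega), fun _ => one_pos⟩
  have hhalf : half P 1 K₀ = L * K₀ := by show L ^ 1 * K₀ = L * K₀; rw [pow_one]
  have hsites : ∀ μ : Fin d, P.sitesPerDir 0 μ = 2 * (L * (K₀ * n)) := by
    intro μ; show 2 * (L ^ (1 - 0) * (K₀ * n) * 1) = _; rw [Nat.sub_zero, pow_one, mul_one]
  have hhalf_pos : 0 < half P 1 K₀ := by rw [hhalf]; omega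
  refine ⟨K₀, hK₀, P, lt_of_lt_of_le (by norm_num) hL, rfl, rfl, Dvd.intro n rfl, le_rfl, ?_, ?_, ?_⟩
  · intro μ
    rw [hhalf, hsites μ]
    calc 3 * (L * K₀) ≤ n * (L * K₀) := Nat.mul_le_mul_right _ hn3
      _ = L * (K₀ * n) := by ring
      _ ≤ 2 * (L * (K₀ * n)) := Nat.le_mul_of_pos_left _ (by norm_num)
  · show (L : ℝ) ^ 1 * ((L : ℝ))⁻¹ ≤ 1
    rw [pow_one, mul_inv_cancel₀ (by exact_mod_cast hL0.ne')]
  -- the slab `Ω` of `n` cells in direction `μ₀`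
  let μ₀ : Fin d := ⟨0, hd⟩
  have hΩbig : IsBigBlockUnion 1 K₀
      (Finset.univ.filter (fun x : HiggsLattice.Site P 0 => (x μ₀).val / half P 1 K₀ < n)) := by
    intro x x' h
    simp only [Finset.mem_filter, Finset.mem_univ, true_and]
    rw [h μ₀]
  -- every label is below the period
  have hlabel : ∀ μ : Fin d, L * ρ₀ + L + ρ₀ < P.sitesPerDir 0 μ := by
    intro μ; rw [hsites μ, ← hn]
    have : n * 1 ≤ n * (L * K₀) := Nat.mul_le_mul_left _ hLK
    nlinarith
  -- interior points: every site whose `μ₀`-label is at most `Lρ₀ + L − 1` and at least `ρ₀`... it suffices: labels in `[ρ₀, Lρ₀ + L)`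
  have hinterior : ∀ z : HiggsLattice.Site P 0, ρ₀ ≤ (z μ₀).val → (z μ₀).val < L * ρ₀ + L →
      Interior 1 K₀ (Finset.univ.filter (fun x : HiggsLattice.Site P 0 => (x μ₀).val / half P 1 K₀ < n)) z := by
    intro z hzlo hzhi y hy
    have hmargin : 2 * rS P 1 K₀ + 2 * half P 1 K₀ * (P.d + 1) + 1 = ρ₀ := by rw [hρ₀]; rfl
    rw [hmargin] at hy
    rw [Finset.mem_filter]
    refine ⟨Finset.mem_univ _, ?_⟩
    have hc : (z μ₀).val < P.sitesPerDir 0 μ₀ := ZMod.val_lt _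
    have hzc : (((z μ₀).val : ℕ) : ZMod (P.sitesPerDir 0 μ₀)) = z μ₀ := ZMod.natCast_zmod_val _
    have hμ : min ((z μ₀) - y μ₀).val (y μ₀ - z μ₀).val ≤ ρ₀ :=
      (Finset.le_sup (f := fun μ : Fin P.d => min ((z μ) - y μ).val (y μ - z μ).val) (Finset.mem_univ μ₀)).trans hy
    have hb : (y μ₀).val ≤ (z μ₀).val + ρ₀ := by
      have h' : min ((((z μ₀).val : ℕ) : ZMod (P.sitesPerDir 0 μ₀)) - y μ₀).val
          (y μ₀ - (((z μ₀).val : ℕ) : ZMod (P.sitesPerDir 0 μ₀))).val ≤ ρ₀ := by rw [hzc]; exact hμ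
      exact val_le_add_of_min_le hc hzlo h'
    calc (y μ₀).val / half P 1 K₀ ≤ (y μ₀).val := Nat.div_le_self _ _
      _ < n := by omega
  refine ⟨Finset.univ.filter (fun x : HiggsLattice.Site P 0 => (x μ₀).val / half P 1 K₀ < n), hΩbig, ?_, ?_, ?_⟩
  · -- proper: the site with label `n·half` in direction `μ₀` is outside
    intro hΩ
    have hlt : n * half P 1 K₀ < P.sitesPerDir 0 μ₀ := by
      rw [hhalf, hsites μ₀]
      calc n * (L * K₀) = L * (K₀ * n) := by ring
        _ < 2 * (L * (K₀ * n)) := by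
          have : 0 < L * (K₀ * n) := Nat.mul_pos hL0 (Nat.mul_pos (by omega) (by omega))
          omega
    let z : HiggsLattice.Site P 0 := fun μ => ((n * half P 1 K₀ : ℕ) : ZMod (P.sitesPerDir 0 μ))
    have hz : z ∈ Finset.univ.filter (fun x : HiggsLattice.Site P 0 => (x μ₀).val / half P 1 K₀ < n) := by
      rw [hΩ]; exact Finset.mem_univ z
    rw [Finset.mem_filter] at hz
    have hval : (z μ₀).val = n * half P 1 K₀ := ZMod.val_cast_of_lt hlt
    have := hz.2
    rw [hval, Nat.mul_div_cancel _ hhalf_pos] at this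
    exact lt_irrefl _ this
  · -- the block corner with all labels `L·ρ₀` has an interior block: every `z` of its `1`-block has `⌊z_{μ₀}/L⌋ = ρ₀`
    have hcorner : (((L * ρ₀ : ℕ) : ZMod (P.sitesPerDir 0 μ₀))).val = L * ρ₀ :=
      ZMod.val_cast_of_lt ((show L * ρ₀ ≤ L * ρ₀ + L + ρ₀ by omega).trans_lt (hlabel μ₀))
    have hblock : ∀ z : HiggsLattice.Site P 0,
        blockIter 1 z = blockIter 1 (fun μ => ((L * ρ₀ : ℕ) : ZMod (P.sitesPerDir 0 μ))) → (z μ₀).val / L = ρ₀ := by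
      intro z hz
      have h3 : ((blockIter 1 z) μ₀).val
          = ((blockIter 1 (fun μ : Fin P.d => ((L * ρ₀ : ℕ) : ZMod (P.sitesPerDir 0 μ)))) μ₀).val := by rw [hz]
      rw [B2Ineq329ZeroAveraging.val_blockIter (k := 1) le_rfl, B2Ineq329ZeroAveraging.val_blockIter (k := 1) le_rfl] at h3
      change (z μ₀).val / L ^ 1 = (((L * ρ₀ : ℕ) : ZMod (P.sitesPerDir 0 μ₀))).val / L ^ 1 at h3
      rw [hcorner, pow_one, Nat.mul_div_cancel_left _ hL0] at h3
      exact h3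
    refine ⟨fun μ => ((L * ρ₀ : ℕ) : ZMod (P.sitesPerDir 0 μ)), fun z hz => hinterior z ?_ ?_⟩
    · -- `z_{μ₀} ≥ (z_{μ₀}/L)·L = ρ₀·L ≥ ρ₀`
      have h1 := hblock z hz
      have h2 := Nat.div_mul_le_self (z μ₀).val L
      rw [h1] at h2
      exact le_trans (Nat.le_mul_of_pos_right ρ₀ hL0) h2
    · -- `z_{μ₀} < (z_{μ₀}/L)·L + L = ρ₀·L + L`
      have h1 := hblock z hz
      have h2 := Nat.lt_div_mul_add (a := (z μ₀).val) hL0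
      rw [h1] at h2
      calc (z μ₀).val < ρ₀ * L + L := h2
        _ = L * ρ₀ + L := by rw [Nat.mul_comm]
  · -- the bond at the same corner has an interior initial point
    refine ⟨⟨fun μ => ((L * ρ₀ : ℕ) : ZMod (P.sitesPerDir 0 μ)), μ₀⟩, hinterior _ ?_ ?_⟩
    · show ρ₀ ≤ (((L * ρ₀ : ℕ) : ZMod (P.sitesPerDir 0 μ₀))).val
      rw [ZMod.val_cast_of_lt ((show L * ρ₀ ≤ L * ρ₀ + L + ρ₀ by omega).trans_lt (hlabel μ₀))]
      nlinarith
    · show (((L * ρ₀ : ℕ) : ZMod (P.sitesPerDir 0 μ₀))).val < L * ρ₀ + L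
      rw [ZMod.val_cast_of_lt ((show L * ρ₀ ≤ L * ρ₀ + L + ρ₀ by omega).trans_lt (hlabel μ₀))]
      omega

end Nonvacuous

end Literature.MathematicalPhysics.QuantumFieldTheory.Balaban1983to89.B3Ineq212ZeroRegion

end
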